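import Summits.FinalStateConjecture.FinalStateConjecture.Theorems.SwallowTheDatumKerrShieldedDataExistBridgeImmersion
import Summits.FinalStateConjecture.FinalStateConjecture.Theorems.SwallowTheDatumKerrShieldedDataExistStubInducedVacuumData
import Summits.FinalStateConjecture.FinalStateConjecture.Theorems.SwallowTheDatumKerrShieldedDataExistStubRicciFlatKS
import Literature.Geometry.Lorentzian.ChartConnection
import HarnessLib

/-!
# `ParametricKerrBurial`, line `null-shell-shadow-collar` — stub `stub_capping`, III: future radial immersions

Support file (everything proved; no definitions, no named facts) for stub `stub_capping` of crux
`stmt-FinalStateConjecture-10052`. The cap is ONE spherically symmetric spacelike immersion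
`y ↦ Φ(y) = τ(s) ∂_{t*} + (ϱ(s)/s)(0, y)`, `s = ‖y‖`, of an annulus `U ⊆ E3 ∖ {0}` into a Schwarzschild Kerr–Schild
chart `Kerr.region 0 r`, equipped with its FUTURE unit normal. The radial toolkit of the sister crux
`KerrShieldedDataExist` (`…BridgeRadial`, `…BridgeImmersion`) provides the spacelike-immersion property and the raw
unit normal `A^{-1/2} Ñ`, `Ñ = (−ϱ′ − (2M/ϱ)(ϱ′ + τ′)) ∂_{t*} + ((−τ′ + (2M/ϱ)(ϱ′ + τ′))/s)(0, y)`; here: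

* `inducedBilin_eq_coord`, `secondFundamentalForm_eq_coord` — the induced metric and the second fundamental form of
  ANY map `f : U → Kerr.region 0 r` with representatives `(Φ, N)`, in coordinates:
  `K(v, w) = g(DN v, DΦ w) + ½ 𝒦(N, DΦ v, DΦ w)` with `g = Kerr.bilin M 0 (Φ y)` and `𝒦` the Koszul form of the
  components (`OpensChart.secondFundamentalForm_eq_of_repr` + `OpensChart.val_christoffel_const`) — the right-hand
  side mentions neither the chart radius `r` nor the chart domain `U`, which is how data induced in different charts
  are compared on overlaps;
* `isUnitNormal_neg` — the opposite of a unit normal is a unit normal;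
* `isFutureUnitNormal_of_radialMap` — for a profile with `ϱ′ + (2M/ϱ)(ϱ′ + τ′) > 0` the OPPOSITE `N = −A^{-1/2} Ñ` of
  the raw normal is the future unit normal (`g(V, N) = −N⁰ < 0`, `Kerr.bilin_timeVector`);
* `exists_radialData` — the packaged ZONE DATUM: `F` is a spacelike immersion, `N` its future unit normal, both with
  smooth representatives, and the induced `(h, K_N)` is a VACUUM initial data set on `U` (`stub_inducedVacuumData`
  fed with `stub_ricciFlatKS`).

References: O'Neill 1983, Ch. 4, Lemma 4.1/4.4 and pp. 106–107, Ch. 5, p. 145; Choquet-Bruhat 2009, Ch. VI, Thm. 3.3.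
-/

-- the doubled `FinalStateConjecture` path component is the summit/problem naming scheme, not a mistake
set_option linter.dupNamespace false

noncomputable section

-- instance search through the nested operator types `E4 →L E4 →L ℝ` (as in the chart-calculus files)
set_option maxSynthPendingDepth 3

open Real Set Filter TopologicalSpace
open scoped Manifold ContDiff Topology InnerProductSpace
open Literature.Geometry.Lorentzian

namespace Summit.FinalStateConjecture.FinalStateConjecture.Theorems.SwallowTheDatum.ParametricKerrBurial

namespace Capping

/-! ### Induced data of maps into a Kerr–Schild chart, in coordinates -/

section Coord

variable [Kerr.Facts] {M r : ℝ} {U : Opens E3} {f : U → Kerr.region 0 r} {Φ N : E3 → E4}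
  {ν : NormalField 𝓘(ℝ, E4) f}

/-- **The induced metric in coordinates**: `(f^*g)_y(v, w) = g_{Φ y}(DΦ(y) v, DΦ(y) w)` for a representative `Φ`
of `f` differentiable at `y`. [cite: ONeill1983, Ch. 4, p. 97] -/
theorem inducedBilin_eq_coord (hf : ∀ y : U, (f y : E4) = Φ y) {y : U} (hΦ : DifferentiableAt ℝ Φ y)
    (v w : E3) :
    (Kerr.smoothMetric M 0 r).inducedBilin 𝓘(ℝ, E3) f y v w =
      Kerr.bilin M 0 (Φ y) (fderiv ℝ Φ y v) (fderiv ℝ Φ y w) := by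
  rw [PseudoRiemannianMetric.inducedBilin_apply, Kerr.smoothMetric_val, OpensChart.mfderiv_apply_of_repr hf hΦ,
    OpensChart.mfderiv_apply_of_repr hf hΦ, hf y]
  rfl

/-- **The second fundamental form in coordinates**, chart-radius-free form:
`K_ν(v, w) = g_{Φ y}(DN(y) v, DΦ(y) w) + ½ 𝒦_{Φ y}(N y, DΦ(y) v, DΦ(y) w)` for representatives `(Φ, N)` of `(f, ν)`
differentiable at `y` (`𝒦` the Koszul form of the components `Kerr.bilin M 0`). [cite: ONeill1983, Ch. 4, Lemma 4.1] -/
theorem secondFundamentalForm_eq_coord [(Kerr.smoothMetric M 0 r).HasLeviCivita]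
    (hf : ∀ y : U, (f y : E4) = Φ y) (hν : ∀ y : U, ν y = N y) {y : U}
    (hΦ : DifferentiableAt ℝ Φ y) (hN : DifferentiableAt ℝ N y) (v w : E3) :
    (Kerr.smoothMetric M 0 r).secondFundamentalForm 𝓘(ℝ, E3) f ν y v w =
      Kerr.bilin M 0 (Φ y) (fderiv ℝ N y v) (fderiv ℝ Φ y w) +
        2⁻¹ * OpensChart.koszulForm (Kerr.bilin M 0) (Φ y) (N y) (fderiv ℝ Φ y v) (fderiv ℝ Φ y w) := by
  rw [OpensChart.secondFundamentalForm_eq_of_repr (g := (Kerr.smoothMetric M 0 r).toPseudoRiemannianMetric)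
    (G := Kerr.bilin M 0) (Kerr.smoothMetric_val M 0 r) hf hν hΦ hN (Kerr.differentiableAt_bilin M 0 _) v w]
  have hΓ := OpensChart.val_christoffel_const (g := (Kerr.smoothMetric M 0 r).toPseudoRiemannianMetric)
    (G := Kerr.bilin M 0) (f y) (N y) (fderiv ℝ Φ y v) (fderiv ℝ Φ y w)
  have hΓ' : Kerr.bilin M 0 (Φ y) (OpensChart.christoffel (Kerr.smoothMetric M 0 r).toPseudoRiemannianMetric
      (Kerr.bilin M 0) (f y) (N y) (fderiv ℝ Φ y v)) (fderiv ℝ Φ y w) =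
      2⁻¹ * OpensChart.koszulForm (Kerr.bilin M 0) (Φ y) (N y) (fderiv ℝ Φ y v) (fderiv ℝ Φ y w) := by
    rw [← hf y]; exact hΓ
  show Kerr.bilin M 0 (f y : E4) (fderiv ℝ N y v + OpensChart.christoffel
      (Kerr.smoothMetric M 0 r).toPseudoRiemannianMetric (Kerr.bilin M 0) (f y) (N y) (fderiv ℝ Φ y v))
      (fderiv ℝ Φ y w) = _
  rw [hf y, map_add, _root_.add_apply, hΓ']

end Coord

/-! ### The future unit normal of a radial immersion -/

section Normal

variable [Kerr.Facts] {M r : ℝ} {S : Set ℝ} {U : Opens E3} {τ ϱ τ' ϱ' : ℝ → ℝ} {Φ N : E3 → E4}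
  {F : U → Kerr.region 0 r}

/-- The opposite of a unit normal of sign `−1` is a unit normal of sign `−1`. [cite: ONeill1983, Ch. 4, pp. 106–107] -/
theorem isUnitNormal_neg (h : (Kerr.smoothMetric M 0 r).IsUnitNormal 𝓘(ℝ, E3) F (fun y ↦ N y) (-1)) :
    (Kerr.smoothMetric M 0 r).IsUnitNormal 𝓘(ℝ, E3) F (fun y ↦ -N y) (-1) := by
  refine ⟨fun y v ↦ ?_, fun y ↦ ?_⟩
  · have h1 : Kerr.bilin M 0 (F y : E4) (N y) (mfderiv 𝓘(ℝ, E3) 𝓘(ℝ, E4) F y v) = 0 := by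
      have h1 := h.1 y v
      rwa [Kerr.smoothMetric_val] at h1
    have key : Kerr.bilin M 0 (F y : E4) (-N y) (mfderiv 𝓘(ℝ, E3) 𝓘(ℝ, E4) F y v) = 0 := by
      rw [map_neg, _root_.neg_apply, h1, neg_zero]
    rw [Kerr.smoothMetric_val]
    exact key
  · have h2 : Kerr.bilin M 0 (F y : E4) (N y) (N y) = -1 := by
      have h2 := h.2 y
      rwa [Kerr.smoothMetric_val] at h2
    have key : Kerr.bilin M 0 (F y : E4) (-N y) (-N y) = -1 := by
      simp only [map_neg, _root_.neg_apply, neg_neg, h2]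
    rw [Kerr.smoothMetric_val]
    exact key

/-- **The future unit normal of a radial immersion.** For a profile with `ϱ > 0`, `A > 0` and
`ϱ′ + (2M/ϱ)(ϱ′ + τ′) > 0` on the radii of `U`, the field `N = −A^{-1/2} Ñ` (opposite of the raw normal of
`Bridge.isUnitNormal_of_radialMap`) is the FUTURE unit normal of `F` for the time orientation `V = −g♯dt*`:
`g(V, N) = −N⁰ = −A^{-1/2}(ϱ′ + (2M/ϱ)(ϱ′ + τ′)) < 0`. [cite: ONeill1983, Ch. 5, p. 145] -/
theorem isFutureUnitNormal_of_radialMap (hM : 0 ≤ M)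
    (hΦ : ∀ y, Φ y = τ ‖y‖ • E4.basisVector 0 + (ϱ ‖y‖ / ‖y‖) • E4.spaceEmbed y)
    (hU0 : ∀ y ∈ U, y ≠ 0) (hUS : ∀ y ∈ U, ‖y‖ ∈ S) (hF : ∀ y : U, (F y : E4) = Φ y)
    (hdτ : ∀ s ∈ S, HasDerivAt τ (τ' s) s) (hdϱ : ∀ s ∈ S, HasDerivAt ϱ (ϱ' s) s)
    (hpos : ∀ s ∈ S, 0 < ϱ s)
    (hA : ∀ s ∈ S, 0 < -τ' s ^ 2 + ϱ' s ^ 2 + 2 * M / ϱ s * (τ' s + ϱ' s) ^ 2)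
    (hfut : ∀ s ∈ S, 0 < ϱ' s + 2 * M / ϱ s * (ϱ' s + τ' s))
    (hN : ∀ y, N y = -((√(-τ' ‖y‖ ^ 2 + ϱ' ‖y‖ ^ 2 + 2 * M / ϱ ‖y‖ * (τ' ‖y‖ + ϱ' ‖y‖) ^ 2))⁻¹ •
      ((-ϱ' ‖y‖ - 2 * M / ϱ ‖y‖ * (ϱ' ‖y‖ + τ' ‖y‖)) • E4.basisVector 0 +
        ((-τ' ‖y‖ + 2 * M / ϱ ‖y‖ * (ϱ' ‖y‖ + τ' ‖y‖)) / ‖y‖) • E4.spaceEmbed y))) :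
    (Kerr.smoothMetric M 0 r).IsFutureUnitNormal 𝓘(ℝ, E3) ((Kerr.timeOrientation M 0 r hM).ofLE le_top)
      F (fun y ↦ N y) := by
  -- the raw normal and its opposite
  set N₀ : E3 → E4 := fun y ↦ (√(-τ' ‖y‖ ^ 2 + ϱ' ‖y‖ ^ 2 + 2 * M / ϱ ‖y‖ * (τ' ‖y‖ + ϱ' ‖y‖) ^ 2))⁻¹ •
      ((-ϱ' ‖y‖ - 2 * M / ϱ ‖y‖ * (ϱ' ‖y‖ + τ' ‖y‖)) • E4.basisVector 0 +
        ((-τ' ‖y‖ + 2 * M / ϱ ‖y‖ * (ϱ' ‖y‖ + τ' ‖y‖)) / ‖y‖) • E4.spaceEmbed y) with hN₀_def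
  have hN₀ : ∀ y, N₀ y = (√(-τ' ‖y‖ ^ 2 + ϱ' ‖y‖ ^ 2 + 2 * M / ϱ ‖y‖ * (τ' ‖y‖ + ϱ' ‖y‖) ^ 2))⁻¹ •
      ((-ϱ' ‖y‖ - 2 * M / ϱ ‖y‖ * (ϱ' ‖y‖ + τ' ‖y‖)) • E4.basisVector 0 +
        ((-τ' ‖y‖ + 2 * M / ϱ ‖y‖ * (ϱ' ‖y‖ + τ' ‖y‖)) / ‖y‖) • E4.spaceEmbed y) := fun _ ↦ rfl
  have hNN₀ : ∀ y, N y = -N₀ y := fun y ↦ by rw [hN, hN₀]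
  have hun₀ := Bridge.isUnitNormal_of_radialMap (M := M) (r₀ := r) (N := N₀) hΦ hU0 hUS hF hdτ hdϱ hpos hA hN₀
  have hun : (Kerr.smoothMetric M 0 r).IsUnitNormal 𝓘(ℝ, E3) F (fun y ↦ N y) (-1) := by
    have hfun : (fun y : U ↦ N (y : E3)) = fun y : U ↦ -N₀ (y : E3) := funext fun y ↦ hNN₀ y
    rw [hfun]
    exact isUnitNormal_neg hun₀
  refine ⟨hun, fun y ↦ ?_⟩
  have hy0 := hU0 y y.2
  have hyS := hUS y y.2
  have hx : 0 < Kerr.radius 0 (F y : E4) := Kerr.radius_pos_of_mem_region (F y).2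
  -- the `∂_{t*}`-component of `N`
  set A := -τ' ‖(y : E3)‖ ^ 2 + ϱ' ‖(y : E3)‖ ^ 2 +
    2 * M / ϱ ‖(y : E3)‖ * (τ' ‖(y : E3)‖ + ϱ' ‖(y : E3)‖) ^ 2 with hA_def
  have hA0 : 0 < A := hA _ hyS
  have h0 : N y 0 = (√A)⁻¹ * (ϱ' ‖(y : E3)‖ + 2 * M / ϱ ‖(y : E3)‖ * (ϱ' ‖(y : E3)‖ + τ' ‖(y : E3)‖)) := by
    rw [hN, ← hA_def]
    simp
    ring
  have h0pos : 0 < N y 0 := by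
    rw [h0]
    exact mul_pos (inv_pos.2 (Real.sqrt_pos.2 hA0)) (hfut _ hyS)
  refine ⟨?_, ?_⟩
  · -- causal: `g(N, N) = −1 ≤ 0`, `N ≠ 0`
    refine ⟨by rw [hun.2 y]; norm_num, fun h ↦ ?_⟩
    have h' : N y = 0 := h
    have : N y 0 = 0 := by rw [h']; rfl
    linarith
  · -- `g(V, N) = −N⁰ < 0`
    rw [TimeOrientation.vectorField_ofLE, Kerr.smoothMetric_val]
    change Kerr.bilin M 0 (F y : E4) (Kerr.timeVector M 0 (F y : E4)) (N y) < 0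
    rw [Kerr.bilin_timeVector hx]
    linarith

omit [Kerr.Facts] in
/-- The representative `N = −A^{-1/2} Ñ` is `C^∞` on `U` (when the profile and its derivative functions are).
[folklore] -/
theorem contDiffOn_futureNormal (hS : IsOpen S) (hϱ : ContDiffOn ℝ ∞ ϱ S)
    (hτ'c : ContDiffOn ℝ ∞ τ' S) (hϱ'c : ContDiffOn ℝ ∞ ϱ' S)
    (hU0 : ∀ y ∈ U, y ≠ 0) (hUS : ∀ y ∈ U, ‖y‖ ∈ S) (hpos : ∀ s ∈ S, 0 < ϱ s)
    (hA : ∀ s ∈ S, 0 < -τ' s ^ 2 + ϱ' s ^ 2 + 2 * M / ϱ s * (τ' s + ϱ' s) ^ 2)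
    (hN : ∀ y, N y = -((√(-τ' ‖y‖ ^ 2 + ϱ' ‖y‖ ^ 2 + 2 * M / ϱ ‖y‖ * (τ' ‖y‖ + ϱ' ‖y‖) ^ 2))⁻¹ •
      ((-ϱ' ‖y‖ - 2 * M / ϱ ‖y‖ * (ϱ' ‖y‖ + τ' ‖y‖)) • E4.basisVector 0 +
        ((-τ' ‖y‖ + 2 * M / ϱ ‖y‖ * (ϱ' ‖y‖ + τ' ‖y‖)) / ‖y‖) • E4.spaceEmbed y))) :
    ContDiffOn ℝ ∞ N (U : Set E3) := by
  set N₀ : E3 → E4 := fun y ↦ (√(-τ' ‖y‖ ^ 2 + ϱ' ‖y‖ ^ 2 + 2 * M / ϱ ‖y‖ * (τ' ‖y‖ + ϱ' ‖y‖) ^ 2))⁻¹ •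
      ((-ϱ' ‖y‖ - 2 * M / ϱ ‖y‖ * (ϱ' ‖y‖ + τ' ‖y‖)) • E4.basisVector 0 +
        ((-τ' ‖y‖ + 2 * M / ϱ ‖y‖ * (ϱ' ‖y‖ + τ' ‖y‖)) / ‖y‖) • E4.spaceEmbed y) with hN₀_def
  have h₀ : ContDiffOn ℝ ∞ N₀ (U : Set E3) :=
    Bridge.contDiffOn_radialNormal (M := M) hS hϱ hτ'c hϱ'c hU0 hUS hpos hA (fun _ ↦ rfl)
  have hNN₀ : N = fun y ↦ -N₀ y := funext fun y ↦ by rw [hN]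
  rw [hNN₀]
  exact h₀.neg

end Normal

/-! ### The zone datum of a future radial immersion -/

section Datum

variable [Kerr.Facts] {M r : ℝ} {S : Set ℝ} {U : Opens E3} {τ ϱ τ' ϱ' : ℝ → ℝ} {Φ N : E3 → E4}
  {F : U → Kerr.region 0 r}

/-- **The zone datum.** Let `(τ, ϱ)` be a profile, `C^∞` on an open set `S` of radii containing the radii of an open
set `U ⊆ E3 ∖ {0}`, with `C^∞` derivative functions `τ′, ϱ′`, `ϱ > 0`, `A = −τ′² + ϱ′² + (2M/ϱ)(τ′ + ϱ′)² > 0` and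
`ϱ′ + (2M/ϱ)(ϱ′ + τ′) > 0` on `S`; let `F : U → Kerr.region 0 r` be represented by the radial map `Φ` and `N` be the
opposite of the raw normal. Then `F` is a spacelike immersion, `N` represents its future unit normal, `Φ` and `N` are
`C^∞` on `U`, and the induced pair `(F^* g, K_N)` is a VACUUM initial data set on `U` (O'Neill 1983, Ch. 4; the
constraints by Gauss–Codazzi and the Ricci-flatness of the chart, Choquet-Bruhat 2009, Ch. VI, Thm. 3.3).
[cite: ChoquetBruhat2009, Ch. VI, Thm. 3.3] -/
theorem exists_radialData (hM : 0 ≤ M) (hS : IsOpen S) (hτ : ContDiffOn ℝ ∞ τ S) (hϱ : ContDiffOn ℝ ∞ ϱ S)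
    (hτ'c : ContDiffOn ℝ ∞ τ' S) (hϱ'c : ContDiffOn ℝ ∞ ϱ' S)
    (hΦ : ∀ y, Φ y = τ ‖y‖ • E4.basisVector 0 + (ϱ ‖y‖ / ‖y‖) • E4.spaceEmbed y)
    (hU0 : ∀ y ∈ U, y ≠ 0) (hUS : ∀ y ∈ U, ‖y‖ ∈ S) (hF : ∀ y : U, (F y : E4) = Φ y)
    (hdτ : ∀ s ∈ S, HasDerivAt τ (τ' s) s) (hdϱ : ∀ s ∈ S, HasDerivAt ϱ (ϱ' s) s)
    (hpos : ∀ s ∈ S, 0 < ϱ s)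
    (hA : ∀ s ∈ S, 0 < -τ' s ^ 2 + ϱ' s ^ 2 + 2 * M / ϱ s * (τ' s + ϱ' s) ^ 2)
    (hfut : ∀ s ∈ S, 0 < ϱ' s + 2 * M / ϱ s * (ϱ' s + τ' s))
    (hN : ∀ y, N y = -((√(-τ' ‖y‖ ^ 2 + ϱ' ‖y‖ ^ 2 + 2 * M / ϱ ‖y‖ * (τ' ‖y‖ + ϱ' ‖y‖) ^ 2))⁻¹ •
      ((-ϱ' ‖y‖ - 2 * M / ϱ ‖y‖ * (ϱ' ‖y‖ + τ' ‖y‖)) • E4.basisVector 0 +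
        ((-τ' ‖y‖ + 2 * M / ϱ ‖y‖ * (ϱ' ‖y‖ + τ' ‖y‖)) / ‖y‖) • E4.spaceEmbed y))) :
    (Kerr.smoothMetric M 0 r).IsSpacelikeImmersion 𝓘(ℝ, E3) F ∧
      (Kerr.smoothMetric M 0 r).IsFutureUnitNormal 𝓘(ℝ, E3) ((Kerr.timeOrientation M 0 r hM).ofLE le_top)
        F (fun y ↦ N y) ∧
      ContDiffOn ℝ ∞ Φ (U : Set E3) ∧ ContDiffOn ℝ ∞ N (U : Set E3) ∧
      ∃ D : InitialDataSet 𝓘(ℝ, E3) U,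
        (∀ y : U, D.h.inner y = (Kerr.smoothMetric M 0 r).inducedBilin 𝓘(ℝ, E3) F y) ∧
        (∀ [(Kerr.smoothMetric M 0 r).HasLeviCivita] (y : U),
          (D.k y).toLinearMap₁₂ = (Kerr.smoothMetric M 0 r).secondFundamentalForm 𝓘(ℝ, E3) F (fun y ↦ N y) y) ∧
        (∀ [D.metric.HasLeviCivita], D.IsVacuumConstraintSolution) := by
  have hsp := Bridge.isSpacelikeImmersion_of_radialMap (M := M) (r₀ := r) hS hτ hϱ hΦ hU0 hUS hF hdτ hdϱ hpos hA
  have hfun := isFutureUnitNormal_of_radialMap hM hΦ hU0 hUS hF hdτ hdϱ hpos hA hfut hN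
  have hΦc : ContDiffOn ℝ ∞ Φ (U : Set E3) := Bridge.contDiffOn_radialMap hS hτ hϱ hΦ hU0 hUS
  have hNc : ContDiffOn ℝ ∞ N (U : Set E3) := contDiffOn_futureNormal hS hϱ hτ'c hϱ'c hU0 hUS hpos hA hN
  obtain ⟨D, hDh, hDk, hDvac⟩ := stub_inducedVacuumData M r U Φ N F (fun y ↦ N y) (stub_ricciFlatKS M r) hF
    (fun _ ↦ rfl) hΦc hNc hsp hfun.1
  exact ⟨hsp, hfun, hΦc, hNc, D, hDh, hDk, hDvac⟩

end Datum

end Capping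

/-- **Registered export of this file** (sub-goal `capping_radialData` of stub `stub_capping`, crux
`stmt-FinalStateConjecture-10052`): the zone datum of a future radial immersion, `Capping.exists_radialData`.
[cite: ChoquetBruhat2009, Ch. VI, Thm. 3.3] -/
theorem capping_radialData :
    ∀ [Kerr.Facts] (M r : ℝ) (S : Set ℝ) (U : TopologicalSpace.Opens E3) (τ ϱ τ' ϱ' : ℝ → ℝ) (Φ N : E3 → E4) (F : U → Kerr.region 0 r) (hM : 0 ≤ M), IsOpen S → ContDiffOn ℝ ∞ τ S → ContDiffOn ℝ ∞ ϱ S → ContDiffOn ℝ ∞ τ' S → ContDiffOn ℝ ∞ ϱ' S → (∀ y, Φ y = τ ‖y‖ • E4.basisVector 0 + (ϱ ‖y‖ / ‖y‖) • E4.spaceEmbed y) → (∀ y ∈ U, y ≠ 0) → (∀ y ∈ U, ‖y‖ ∈ S) → (∀ y : U, (F y : E4) = Φ y) → (∀ s ∈ S, HasDerivAt τ (τ' s) s) → (∀ s ∈ S, HasDerivAt ϱ (ϱ' s) s) → (∀ s ∈ S, 0 < ϱ s) → (∀ s ∈ S, 0 < -τ' s ^ 2 + ϱ' s ^ 2 +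 2 * M / ϱ s * (τ' s + ϱ' s) ^ 2) → (∀ s ∈ S, 0 < ϱ' s + 2 * M / ϱ s * (ϱ' s + τ' s)) → (∀ y, N y = -((√(-τ' ‖y‖ ^ 2 + ϱ' ‖y‖ ^ 2 + 2 * M / ϱ ‖y‖ * (τ' ‖y‖ + ϱ' ‖y‖) ^ 2))⁻¹ • ((-ϱ' ‖y‖ - 2 * M / ϱ ‖y‖ * (ϱ' ‖y‖ + τ' ‖y‖)) • E4.basisVector 0 + ((-τ' ‖y‖ + 2 * M / ϱ ‖y‖ * (ϱ' ‖y‖ + τ' ‖y‖)) / ‖y‖) • E4.spaceEmbed y))) → (Kerr.smoothMetric M 0 r).IsSpacelikeImmersion 𝓘(ℝ, E3) F ∧ (Kerr.smoothMetric M 0 r).IsFutureUnitNormal 𝓘(ℝ, E3) ((Kerr.timeOrientation M 0 r hM).ofLE le_top) F (fun y ↦ N y) ∧ ContDiffOn ℝ ∞ Φ (U : Set E3) ∧ ContDiffOn ℝ ∞ N (U : Set E3) ∧ ∃ D : InitialDataSet 𝓘(ℝ, E3) U, (∀ y : U, D.h.inner y = (Kerr.smoothMetric M 0 r).inducedBilin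 𝓘(ℝ, E3) F y) ∧ (∀ [(Kerr.smoothMetric M 0 r).HasLeviCivita] (y : U), (D.k y).toLinearMap₁₂ = (Kerr.smoothMetric M 0 r).secondFundamentalForm 𝓘(ℝ, E3) F (fun y ↦ N y) y) ∧ (∀ [D.metric.HasLeviCivita], D.IsVacuumConstraintSolution) :=
  fun _ _ _ _ _ _ _ _ _ _ _ hM hS hτ hϱ hτ'c hϱ'c hΦ hU0 hUS hF hdτ hdϱ hpos hA hfut hN ↦
    Capping.exists_radialData hM hS hτ hϱ hτ'c hϱ'c hΦ hU0 hUS hF hdτ hdϱ hpos hA hfut hN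

end Summit.FinalStateConjecture.FinalStateConjecture.Theorems.SwallowTheDatum.ParametricKerrBurial

end
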